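import Mathlib
import Literature.NumberTheory.LFunctions.Zhang2022.SkeletonPartThree
import HarnessLib

/-!
# Zhang (2022), typed statements of §7, proof of Proposition 7.1 part (c): the main term `𝔗₁₁`
# (slice L2-t5: tex L2063–L2178, PDF pp. 39–42)

Topic `Literature/NumberTheory/LFunctions/Zhang2022` (Landau–Siegel audit tree; verdict-neutral).
Y. Zhang, *Discrete mean estimates and the Landau–Siegel zero*, arXiv:2211.02515v1 (2022)
[Zhang2022LandauSiegel] — **an unrefereed manuscript under adjudication; every `def … : Prop` below
is a CLAIM OF THE MANUSCRIPT, STATED NOT ASSERTED** (statement-only; typed ≠ discharged).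

This file types, statement-exact and in the manuscript's order, the third part of the proof of
Proposition 7.1 ("*Proof of Proposition 7.1: The main term*", §7 pp. 39–42): the chain
(7.16) → (7.17) → (7.18) → (7.19) (Mellin) → Euler-product identity → contour shift → residues
`𝔯ⱼ` at `s = 1 − β_j` → (7.20) with `S*ⱼ` → Möbius inversion → (7.21) `S*ⱼ = S_j` → the three
evaluations `i𝔯ⱼp^{−β_j} = (½, 2, 3/2)·α⁻¹ + O(𝓛)` → (7.10). DAG nodes (plan/DAG.tsv ids):
`Z22:Prop7.1.pf.c-main`, `Z22:(7.16)`–`Z22:(7.21)`, `Z22:§7.u042`–`Z22:§7.u060` (26 nodes).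

| decl | node | locator | kind |
|---|---|---|---|
| `Iface.frakT11` | `Z22:§7.u029` (owner L2-t3) | §7 p.37, tex L1964 | IFACE-STUB object `𝔗₁₁(p)` |
| `Iface.Eq710` | `Z22:(7.10)` (owner L2-t3) | §7 (7.10) p.37, tex L1973 | IFACE-STUB claim |
| `Eq716` | `Z22:(7.16)` | p.39, L2070 | CLAIM |
| `Step7u042` | `Z22:§7.u042` | p.39, L2074 | CLAIM (identity) |
| `Eq717` | `Z22:(7.17)` | p.39, L2078 | CLAIM (identity) |
| `innerDeltaSum`, `Step7u043` | `Z22:§7.u043` | p.39, L2082 | OBJECT + CLAIM |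
| `Eq718` | `Z22:(7.18)` | p.39, L2087 | CLAIM |
| `kapSer`, `Eq719` | `Z22:(7.19)` | p.40, L2093 | OBJECT + CLAIM |
| `Step7u044` | `Z22:§7.u044` | p.40, L2097 | CLAIM |
| `Step7u045a`, `zetaRatio`, `Step7u045` | `Z22:§7.u045` | p.40, L2100–L2102 | CLAIMS + OBJECT |
| `tauFive`, `Step7u046` | `Z22:§7.u046` | p.40, L2105 | OBJECT + CLAIM |
| `vert747`, `horiz748`, `contour719`, `Step7u047` | `Z22:§7.u047`, `Z22:§7.u048` | p.40, L2108–L2117 | OBJECTS + CLAIM |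
| `Step7u049` | `Z22:§7.u049` | p.40, L2118–L2121 | CLAIM |
| `resFn`, `frakr`, `Step7u050` | `Z22:§7.u050` | p.40, L2122–L2126 | OBJECTS + CLAIM |
| `eps1` | `Z22:§7.u051` | p.40, L2127 | OBJECT |
| `Step7u052` | `Z22:§7.u052` | p.41, L2131 | CLAIM |
| `Eq720` | `Z22:(7.20)` | p.41, L2138 | CLAIM |
| `SjStar` | `Z22:§7.u053` | p.41, L2143 | OBJECT |
| `Step7u054` | `Z22:§7.u054` | p.41, L2146 | CLAIM (identity) |
| `Step7u055` | `Z22:§7.u055` | p.41, L2152 | CLAIM (identity) |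
| `Step7u056` | `Z22:§7.u056` | p.41, L2156 | CLAIM (identity) |
| `Step7u057` | `Z22:§7.u057` | p.41, L2160 | CLAIM (identity) |
| `Eq721` | `Z22:(7.21)` | p.41, L2165 | CLAIM |
| `Step7u058`, `Step7u059`, `Step7u060` | `Z22:§7.u058`–`u060` | p.42, L2169–L2176 | CLAIMS |
| `DedProp71c` | `Z22:Prop7.1.pf.c-main` | pp.39–42, L2063–L2178 | deduction node (refines `Skeleton.Ded71`) |

Conventions (skel/INTERFACE.md §3, plan/L2/ASSIGNMENTS.md §A): the standing context of §7 — `D`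
large, `χ (mod D)` real primitive, Assumption (A) (in force from §5 on, tex L1560), `𝐚₁, 𝐚₂`
satisfying (7.2) (`Skeleton.Adm72 D B a` with the bound `B` explicit), `p ∼ P`
(`p ∈ Skeleton.primeWindow D`), `1 ≤ j ≤ 3`, and the constant `c′` of (2.13) as an explicit
parameter — is rendered by `Skeleton.ForAllLarge fun D _ χ => Skeleton.AssumptionA D χ → …`;
"`X = M + O(E)`" ↦ `∃ C, … ‖X − M‖ ≤ C * E`; Zhang's `ε₁ = exp{−c𝓛^{1/10}}` carries an unspecified
`c > 0` ↦ `∃ c > 0`. Sums "`Σ_n`" over positive integers against a sequence of support `< PT⁻²`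
((7.2)) are finite sums over `Finset.Ico 1 (Skeleton.Nsupp D)`; genuinely infinite sums (over `l`
in `(κ ∗ a₁)(dl)Δ(l/pk)`) are `tsum`s with the guard `0 < l`. Purely algebraic identities
((7.17), the Möbius steps, the `λ₀ⱼ` factorisation) are typed as bare `∀`-statements.
"`(1/2πi)∫_{(c)} F(s) x^{−s} ds`" is Mathlib's `mellinInv c F x`.

Objects of other slices (plan/L2/ASSIGNMENTS.md §D): `𝔗₁₁(p)` and (7.10) belong to slice L2-t3;
they appear here as MARKED interface stubs in the sub-namespace `Iface` (literal readings of tex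
L1964 and L1973), to be replaced by the owner's declarations when `Section7bStatements` lands.
Everything else is CITED from the banked skeleton (`Skeleton.kappaZ/kappaTilde/kappaTildeZero/lam/
lamZero/lamTildeZero/xiZero/Sj/Nsupp/Adm72/DeltaW/deltaW/betaJ/beta1/beta2/beta3/alpha/ell/bigP/
bigT/primeWindow/nset/Lemma52/Lemma54/Ded71`) and from `MeanSquareMajorant.conv` (`κ ∗ a`).

WHAT THIS IS NOT: any claim about Theorems 1–2 of the manuscript or about Landau–Siegel zeros; no
node here is asserted, discharged or refuted; the citation slips recorded in `AMBIGUITY:` notes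
("Lemma 5.2 (i)/(ii)" for Lemma 5.4 (i)/(ii); "the integral (7.18)" for (7.19); the stray
`Σ_{d=d₁d₂}` in the display after "This yields") are recorded, not adjudicated.

## References

* Y. Zhang, arXiv:2211.02515v1 (2022), §7 pp. 39–42, tex L2063–L2178; context §7 pp. 32–37
  (definitions of `𝔫, κ̃, λ, ξ₀ⱼ, κ, 𝔗₁₁`, (7.2), (7.10)), §5 Lemma 5.4, (5.7), (5.14).
  [cite: Zhang2022LandauSiegel, §7 pp. 39–42]
-/

noncomputable section

open Complex Real MeasureTheory

namespace Literature.NumberTheory.LFunctions.Zhang2022.Section7dStatements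

/-! ## Interface stubs for objects owned by slice L2-t3 (`𝔗₁₁(p)`, (7.10)) -/

namespace Iface

/-- `Z22:§7.u029` IFACE-STUB of `𝔗₁₁(p)` owned by L2-t3; TODO-merge.
**`𝔗₁₁(p) = Σ_d d⁻¹ Σ_l Σ_{(k,l)=1} (κ ∗ a₁)(dl)a₂(dk)μ(k)/(kφ(k)) Δ(l/(pk))`** (§7 p. 37, the
display after (7.9)); `κ ∗ a₁` is `MeanSquareMajorant.conv`, `Δ` is `Skeleton.DeltaW`; `d, k` run
over `[1, ⌈PT⁻²⌉)` (by (7.2) `a₂(dk) = 0` beyond), `l ≥ 1` is a series (the term `l = 0` vanishes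
since `(κ ∗ a₁)(0) = 0`). [cite: Zhang2022LandauSiegel, §7 p.37, tex L1964] -/
def frakT11 (c' : ℝ) (D : ℕ) (a₁ a₂ : ℕ → ℂ) (p : ℕ) : ℂ :=
  ∑ d ∈ Finset.Ico 1 (Skeleton.Nsupp D), (d : ℂ)⁻¹ *
    ∑' l : ℕ, ∑ k ∈ (Finset.Ico 1 (Skeleton.Nsupp D)).filter (fun k => Nat.Coprime k l),
      MeanSquareMajorant.conv (Skeleton.kappaZ c' D) a₁ (d * l) * a₂ (d * k) *
          (ArithmeticFunction.moebius k : ℂ) / ((k : ℂ) * (Nat.totient k : ℂ)) *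
        Skeleton.DeltaW D ((l : ℝ) / ((p : ℝ) * k))

/-- `Z22:(7.10)` IFACE-STUB of (7.10) owned by L2-t3; TODO-merge. **(7.10)** (§7 p. 37): for
`p ∼ P`, "`i𝔗₁₁(p) = (p/α)(½S₁(𝐚₁,𝐚₂) + 2S₂(𝐚₁,𝐚₂) + (3/2)S₃(𝐚₁,𝐚₂))
+ O(P𝓛² Σ_{1≤j≤3}|S_j(𝐚₁,𝐚₂)|) + o(P)`" (`S_j` = `Skeleton.Sj`). CLAIM, stated not asserted;
the conclusion of this slice's deduction node `DedProp71c`.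
[cite: Zhang2022LandauSiegel, §7 (7.10) p.37, tex L1973] -/
def Eq710 (c' : ℝ) : Prop :=
  ∀ B : ℝ, ∀ ε : ℝ, 0 < ε → ∃ C : ℝ, Skeleton.ForAllLarge fun D _ χ => Skeleton.AssumptionA D χ →
    ∀ a₁ a₂ : ℕ → ℂ, Skeleton.Adm72 D B a₁ → Skeleton.Adm72 D B a₂ →
      ∀ p ∈ Skeleton.primeWindow D,
        ‖I * frakT11 c' D a₁ a₂ p -
            (p : ℂ) / (Skeleton.alpha D : ℂ) *
              (1 / 2 * Skeleton.Sj c' D 1 a₁ a₂ + 2 * Skeleton.Sj c' D 2 a₁ a₂ +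
                3 / 2 * Skeleton.Sj c' D 3 a₁ a₂)‖
          ≤ C * Skeleton.bigP D * Skeleton.ell D ^ 2 *
              (‖Skeleton.Sj c' D 1 a₁ a₂‖ + ‖Skeleton.Sj c' D 2 a₁ a₂‖ + ‖Skeleton.Sj c' D 3 a₁ a₂‖) +
            ε * Skeleton.bigP D

end Iface

/-! ## Objects of the slice -/

section Objects

variable (c' : ℝ) (D : ℕ)

/-- `Z22:§7.u046` OBJECT (auxiliary). **`τ₅(n)`**, the five-fold divisor function
`#{(n₁,…,n₅) : n₁⋯n₅ = n}` (the coefficients of `ζ(s)⁵`), appearing in the "simple bound" for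
`κ̃(d₁;d₂k,s)`; typed as the fifth Dirichlet-convolution power of `ArithmeticFunction.zeta`.
[folklore] -/
def tauFive (n : ℕ) : ℕ := (ArithmeticFunction.zeta ^ 5 : ArithmeticFunction ℕ) n

/-- `Z22:§7.u051` OBJECT. **`ε₁ = exp{−c𝓛^{1/10}}`** (§7 p. 40), with the manuscript's unspecified
positive constant `c` explicit. [cite: Zhang2022LandauSiegel, §7 p.40, tex L2127] -/
def eps1 (c : ℝ) (D : ℕ) : ℝ := Real.exp (-(c * Skeleton.ell D ^ ((1 : ℝ) / 10)))

/-- `Z22:§7.u045` OBJECT (auxiliary). **`ζ(s+β₁)ζ(s+β₂)ζ(s+β₃)/ζ(s)`** — the generating function of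
`κ` (§7 p. 34: `Σ_n κ(n)n^{−s} = ζ(s+β₁)ζ(s+β₂)ζ(s+β₃)/ζ(s)`; tree: `MeanSquareMajorant.LSeries_kappa`
for `σ > 1`), as a function of `s` (meromorphic continuation included).
[cite: Zhang2022LandauSiegel, §7 p.40, tex L2102] -/
def zetaRatio (s : ℂ) : ℂ :=
  riemannZeta (s + Skeleton.beta1 c' D) * riemannZeta (s + Skeleton.beta2 c' D) *
      riemannZeta (s + Skeleton.beta3 c' D) / riemannZeta s

/-- `Z22:§7.u050` OBJECT. "**the function `ζ(s+β₁)ζ(s+β₂)ζ(s+β₃)ζ(s)⁻¹δ(s)`**" whose residues at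
`s = 1 − β_j` are the `𝔯ⱼ` (§7 p. 40; `δ` = `Skeleton.deltaW`, (5.14)).
[cite: Zhang2022LandauSiegel, §7 p.40, tex L2123] -/
def resFn (s : ℂ) : ℂ := zetaRatio c' D s * Skeleton.deltaW D s

/-- `Z22:§7.u050` OBJECT. **`𝔯ⱼ`**, "the residue of the function `ζ(s+β₁)ζ(s+β₂)ζ(s+β₃)ζ(s)⁻¹δ(s)`
at `s = 1 − β_j`" (§7 p. 40), typed by its value at a simple pole of `ζ(s+β_j)` (residue `1`):
`𝔯ⱼ = ζ(1−β_j+β_{j+1})ζ(1−β_j+β_{j+2})δ(1−β_j)/ζ(1−β_j)` (indices mod 3, `Skeleton.betaJ`); that this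
IS the residue is the claim `Step7u050`. [cite: Zhang2022LandauSiegel, §7 p.40, tex L2122] -/
def frakr (j : ℕ) : ℂ :=
  riemannZeta (1 - Skeleton.betaJ c' D j + Skeleton.betaJ c' D (j + 1)) *
        riemannZeta (1 - Skeleton.betaJ c' D j + Skeleton.betaJ c' D (j + 2)) *
      Skeleton.deltaW D (1 - Skeleton.betaJ c' D j) /
    riemannZeta (1 - Skeleton.betaJ c' D j)

/-- `Z22:(7.19)` OBJECT. The Dirichlet series **`Σ_{(l,m)=1} κ(d₁l)l^{−s}`** of (7.19) (there with
`m = d₂k`), as Mathlib's `LSeries` of `l ↦ 𝟙[(l,m)=1]κ(d₁l)`.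
[cite: Zhang2022LandauSiegel, §7 (7.19) p.40, tex L2094] -/
def kapSer (d₁ m : ℕ) (s : ℂ) : ℂ :=
  LSeries (fun l => if Nat.Coprime l m then Skeleton.kappaZ c' D (d₁ * l) else 0) s

/-- `Z22:§7.u043` OBJECT. The innermost sum **`Σ_{(l,m)=1} κ(d₁l)Δ(l·y)`** (§7 p. 39, "Hence …"
and (7.18), with `m = kd₂`, `y = l₂/(pk)` so that `Δ(l·y) = Δ(l l₂/(pk))`); a series over `l ≥ 1`.
[cite: Zhang2022LandauSiegel, §7 p.39, tex L2083] -/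
def innerDeltaSum (d₁ m : ℕ) (y : ℝ) : ℂ :=
  ∑' l : ℕ, if 0 < l ∧ Nat.Coprime l m then
    Skeleton.kappaZ c' D (d₁ * l) * Skeleton.DeltaW D ((l : ℝ) * y) else 0

/-- `Z22:§7.u047` OBJECT. The integral of `F` over "**the vertical segments `s = 1 + α + it` with
`|t| ≥ D`, `s = 1 − 𝓛⁻¹ + it` with `|t| ≤ D`**" (§7 p. 40), normalised by `1/(2πi)` and oriented
upwards (`ds = i dt`). [cite: Zhang2022LandauSiegel, §7 p.40, tex L2109] -/
def vert747 (D : ℕ) (F : ℂ → ℂ) : ℂ :=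
  1 / (2 * (π : ℂ)) *
    ((∫ t in Set.Iic (-(D : ℝ)), F (1 + Skeleton.alpha D + t * I)) +
      (∫ t in Set.Ici (D : ℝ), F (1 + Skeleton.alpha D + t * I)) +
      ∫ t in Set.Icc (-(D : ℝ)) D, F (1 - (Skeleton.ell D)⁻¹ + t * I))

/-- `Z22:§7.u048` OBJECT. The integral of `F` over "**the two connecting horizontal segments
`s = σ ± iD` with `1 − 𝓛⁻¹ ≤ σ ≤ 1 + α`**" (§7 p. 40), normalised by `1/(2πi)`, oriented so that
together with `vert747` the contour runs upwards (the lower segment from `1 + α − iD` to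
`1 − 𝓛⁻¹ − iD`, the upper one from `1 − 𝓛⁻¹ + iD` to `1 + α + iD`).
[cite: Zhang2022LandauSiegel, §7 p.40, tex L2115] -/
def horiz748 (D : ℕ) (F : ℂ → ℂ) : ℂ :=
  1 / (2 * (π : ℂ) * I) *
    ((∫ σ in (1 - (Skeleton.ell D)⁻¹)..(1 + Skeleton.alpha D), F (σ + D * I)) -
      ∫ σ in (1 - (Skeleton.ell D)⁻¹)..(1 + Skeleton.alpha D), F (σ - D * I))

/-- `Z22:§7.u047`, `Z22:§7.u048` OBJECT. The shifted contour of (7.19): vertical pieces plus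
horizontal pieces, `(1/2πi)∫_𝒞 F(s) ds`. [cite: Zhang2022LandauSiegel, §7 p.40, tex L2108–L2117] -/
def contour719 (D : ℕ) (F : ℂ → ℂ) : ℂ := vert747 D F + horiz748 D F

/-- `Z22:§7.u053` OBJECT. **`S*ⱼ(𝐚₁,𝐚₂) = Σ_d Σ_{d₁} Σ_k a₂(d₁dk)κ̃₀ⱼ(d₁;dk)λ₀ⱼ(d₁dk)μ(k)
/(d₁dφ(k)k^{β_j}) · Σ_{(l,k)=1} a₁(dl)l^{−(1−β_j)}`** (§7 p. 41, after (7.20)); all four sums are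
finite by (7.2) and are truncated at `⌈PT⁻²⌉ = Skeleton.Nsupp D`.
[cite: Zhang2022LandauSiegel, §7 p.41, tex L2143] -/
def SjStar (D : ℕ) (j : ℕ) (a₁ a₂ : ℕ → ℂ) : ℂ :=
  ∑ d ∈ Finset.Ico 1 (Skeleton.Nsupp D), ∑ d₁ ∈ Finset.Ico 1 (Skeleton.Nsupp D),
    ∑ k ∈ Finset.Ico 1 (Skeleton.Nsupp D),
      a₂ (d₁ * d * k) * Skeleton.kappaTildeZero c' D j d₁ (d * k) *
            Skeleton.lamZero c' D j (d₁ * d * k) * (ArithmeticFunction.moebius k : ℂ) /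
          ((d₁ : ℂ) * d * (Nat.totient k : ℂ) * (k : ℂ) ^ Skeleton.betaJ c' D j) *
        ∑ l ∈ (Finset.Ico 1 (Skeleton.Nsupp D)).filter (fun l => Nat.Coprime l k),
          a₁ (d * l) / (l : ℂ) ^ (1 - Skeleton.betaJ c' D j)

end Objects

/-! ## The displayed claims, in the manuscript's order -/

section Claims

variable (c' : ℝ)

/-- `Z22:(7.16)` CLAIM. "Assume `p ∼ P`. We may write
**`𝔗₁₁(p) = Σ_d d⁻¹ Σ_k a₂(dk)μ(k)/(kφ(k)) Σ_{(l,k)=1} (κ ∗ a₁)(dl)Δ(l/(pk))`**" (§7 p. 39) — the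
`k`- and `l`-sums of the definition of `𝔗₁₁(p)` interchanged. Refines `Skeleton.Ded71 c'` (first
step of part (c)). [cite: Zhang2022LandauSiegel, §7 (7.16) p.39, tex L2070] -/
def Eq716 : Prop :=
  ∀ B : ℝ, Skeleton.ForAllLarge fun D _ χ => Skeleton.AssumptionA D χ →
    ∀ a₁ a₂ : ℕ → ℂ, Skeleton.Adm72 D B a₁ → Skeleton.Adm72 D B a₂ →
      ∀ p ∈ Skeleton.primeWindow D,
        Iface.frakT11 c' D a₁ a₂ p =
          ∑ d ∈ Finset.Ico 1 (Skeleton.Nsupp D), (d : ℂ)⁻¹ *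
            ∑ k ∈ Finset.Ico 1 (Skeleton.Nsupp D),
              a₂ (d * k) * (ArithmeticFunction.moebius k : ℂ) / ((k : ℂ) * (Nat.totient k : ℂ)) *
                ∑' l : ℕ, if 0 < l ∧ Nat.Coprime l k then
                  MeanSquareMajorant.conv (Skeleton.kappaZ c' D) a₁ (d * l) *
                    Skeleton.DeltaW D ((l : ℝ) / ((p : ℝ) * k)) else 0

/-- `Z22:§7.u042` CLAIM (arithmetic identity). "Since
**`(κ ∗ a₁)(dl) = Σ_{m₁m₂=dl} κ(m₁)a₁(m₂) = Σ_{d=d₁d₂} Σ_{m₁m₂=dl, (m₁,d)=d₁} κ(m₁)a₁(m₂)`**"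
(§7 p. 39): the divisor pairs of `dl` grouped by `d₁ = (m₁, d)`. The first equality is the
definition of `MeanSquareMajorant.conv`; typed is the second.
[cite: Zhang2022LandauSiegel, §7 p.39, tex L2074] -/
def Step7u042 : Prop :=
  ∀ (D : ℕ) (a₁ : ℕ → ℂ) (d l : ℕ), 0 < d → 0 < l →
    MeanSquareMajorant.conv (Skeleton.kappaZ c' D) a₁ (d * l) =
      ∑ d₁ ∈ d.divisors,
        ∑ x ∈ (d * l).divisorsAntidiagonal.filter (fun x => Nat.gcd x.1 d = d₁),
          Skeleton.kappaZ c' D x.1 * a₁ x.2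

/-- `Z22:(7.17)` CLAIM (arithmetic identity). "it follows, by substituting `m₁ = d₁l₁`, that
**`(κ ∗ a₁)(dl) = Σ_{d=d₁d₂} Σ_{l=l₁l₂, (l₁,d₂)=1} κ(d₁l₁)a₁(d₂l₂)`**" (§7 p. 39) (`d₂ = d/d₁`).
[cite: Zhang2022LandauSiegel, §7 (7.17) p.39, tex L2078] -/
def Eq717 : Prop :=
  ∀ (D : ℕ) (a₁ : ℕ → ℂ) (d l : ℕ), 0 < d → 0 < l →
    MeanSquareMajorant.conv (Skeleton.kappaZ c' D) a₁ (d * l) =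
      ∑ d₁ ∈ d.divisors,
        ∑ x ∈ l.divisorsAntidiagonal.filter (fun x => Nat.Coprime x.1 (d / d₁)),
          Skeleton.kappaZ c' D (d₁ * x.1) * a₁ (d / d₁ * x.2)

/-- `Z22:§7.u043` CLAIM. "Hence, **`Σ_{(l,k)=1} (κ ∗ a₁)(dl)Δ(l/(pk))
= Σ_{d=d₁d₂} Σ_{(l₂,k)=1} a₁(d₂l₂) Σ_{(l₁,kd₂)=1} κ(d₁l₁)Δ(l₁l₂/(pk))`**" (§7 p. 39) — (7.17)
summed against `Δ(l/(pk))` over `(l,k) = 1` and rearranged (absolutely convergent series; the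
innermost sum is `innerDeltaSum`). [cite: Zhang2022LandauSiegel, §7 p.39, tex L2082] -/
def Step7u043 : Prop :=
  ∀ B : ℝ, Skeleton.ForAllLarge fun D _ χ => Skeleton.AssumptionA D χ →
    ∀ a₁ : ℕ → ℂ, Skeleton.Adm72 D B a₁ → ∀ p ∈ Skeleton.primeWindow D,
      ∀ d k : ℕ, 0 < d → 0 < k →
        (∑' l : ℕ, if 0 < l ∧ Nat.Coprime l k then
            MeanSquareMajorant.conv (Skeleton.kappaZ c' D) a₁ (d * l) *
              Skeleton.DeltaW D ((l : ℝ) / ((p : ℝ) * k)) else 0) =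
          ∑ d₁ ∈ d.divisors,
            ∑' l₂ : ℕ, if 0 < l₂ ∧ Nat.Coprime l₂ k then
              a₁ (d / d₁ * l₂) *
                innerDeltaSum c' D d₁ (d / d₁ * k) ((l₂ : ℝ) / ((p : ℝ) * k)) else 0

/-- `Z22:(7.18)` CLAIM. "Inserting this into (7.16) we obtain
**`𝔗₁₁(p) = Σ_{d₁} Σ_{d₂} (d₁d₂)⁻¹ Σ_k a₂(d₁d₂k)μ(k)/(kφ(k)) Σ_{(l₂,k)=1} a₁(d₂l₂)
Σ_{(l₁,d₂k)=1} κ(d₁l₁)Δ(l₁l₂/(pk))`**" (§7 p. 39). Refines `Skeleton.Ded71 c'`.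
[cite: Zhang2022LandauSiegel, §7 (7.18) p.39, tex L2087] -/
def Eq718 : Prop :=
  ∀ B : ℝ, Skeleton.ForAllLarge fun D _ χ => Skeleton.AssumptionA D χ →
    ∀ a₁ a₂ : ℕ → ℂ, Skeleton.Adm72 D B a₁ → Skeleton.Adm72 D B a₂ →
      ∀ p ∈ Skeleton.primeWindow D,
        Iface.frakT11 c' D a₁ a₂ p =
          ∑ d₁ ∈ Finset.Ico 1 (Skeleton.Nsupp D), ∑ d₂ ∈ Finset.Ico 1 (Skeleton.Nsupp D),
            ((d₁ : ℂ) * d₂)⁻¹ *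
              ∑ k ∈ Finset.Ico 1 (Skeleton.Nsupp D),
                a₂ (d₁ * d₂ * k) * (ArithmeticFunction.moebius k : ℂ) /
                    ((k : ℂ) * (Nat.totient k : ℂ)) *
                  ∑' l₂ : ℕ, if 0 < l₂ ∧ Nat.Coprime l₂ k then
                    a₁ (d₂ * l₂) * innerDeltaSum c' D d₁ (d₂ * k) ((l₂ : ℝ) / ((p : ℝ) * k))
                  else 0

/-- `Z22:(7.19)` CLAIM. "The innermost sum is, by the Mellin transform, equal to
**`(1/2πi)∫_{(3/2)} (Σ_{(l,d₂k)=1} κ(d₁l)l^{−s}) (pk/l₂)^s δ(s) ds`**" (§7 p. 40; here `l` stands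
for `l₁`; `δ` = `Skeleton.deltaW` (5.14); `(pk/l₂)^s = x^{−s}` with `x = l₂/(pk)`, so the right
side is `mellinInv (3/2) (Σκl^{−s}·δ) x`). The referees' "(7.19) contour" item lives at the next
nodes (`Step7u047`, `Step7u049`). [cite: Zhang2022LandauSiegel, §7 (7.19) p.40, tex L2093] -/
def Eq719 : Prop :=
  Skeleton.ForAllLarge fun D _ χ => Skeleton.AssumptionA D χ →
    ∀ p ∈ Skeleton.primeWindow D, ∀ d₁ d₂ k l₂ : ℕ, 0 < d₁ → 0 < d₂ → 0 < k → 0 < l₂ →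
      innerDeltaSum c' D d₁ (d₂ * k) ((l₂ : ℝ) / ((p : ℝ) * k)) =
        mellinInv (3 / 2) (fun s => kapSer c' D d₁ (d₂ * k) s * Skeleton.deltaW D s)
          ((l₂ : ℝ) / ((p : ℝ) * k))

/-- `Z22:§7.u044` CLAIM. "In view of (7.2), we can assume that **`d₂l₂ < PT⁻²`, `d₁d₂k < PT⁻²`**"
(§7 p. 40): the terms of (7.18) with `d₂l₂ ≥ PT⁻²` or `d₁d₂k ≥ PT⁻²` vanish, by the support clause
of (7.2) (`Skeleton.Adm72`). [cite: Zhang2022LandauSiegel, §7 p.40, tex L2097] -/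
def Step7u044 : Prop :=
  ∀ (D : ℕ) (B : ℝ) (a₁ a₂ : ℕ → ℂ), Skeleton.Adm72 D B a₁ → Skeleton.Adm72 D B a₂ →
    ∀ d₁ d₂ k l₂ : ℕ,
      (Skeleton.bigP D / Skeleton.bigT D ^ 2 ≤ ((d₂ * l₂ : ℕ) : ℝ) → a₁ (d₂ * l₂) = 0) ∧
        (Skeleton.bigP D / Skeleton.bigT D ^ 2 ≤ ((d₁ * d₂ * k : ℕ) : ℝ) → a₂ (d₁ * d₂ * k) = 0)

/-- `Z22:§7.u045` CLAIM (arithmetic). "Every `l` with `(l, d₂k) = 1` can be **uniquely written as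
`l = hr` such that `h ∈ 𝔫(d₁)`, `(h, d₂k) = 1` and `(r, d₁d₂k) = 1`**" (§7 p. 40; `𝔫` =
`Skeleton.nset`; here `m = d₂k`). [cite: Zhang2022LandauSiegel, §7 p.40, tex L2100] -/
def Step7u045a : Prop :=
  ∀ d₁ m l : ℕ, 0 < d₁ → 0 < m → 0 < l → Nat.Coprime l m →
    ∃! hr : ℕ × ℕ, hr.1 * hr.2 = l ∧ hr.1 ∈ Skeleton.nset d₁ ∧ Nat.Coprime hr.1 m ∧
      Nat.Coprime hr.2 (d₁ * m)

/-- `Z22:§7.u045` CLAIM. "Hence, **`Σ_{(l,kd₂)=1} κ(d₁l)l^{−s}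
= κ̃(d₁;d₂k,s)λ(d₁d₂k,s)·ζ(s+β₁)ζ(s+β₂)ζ(s+β₃)/ζ(s)`**" (§7 p. 40; `κ̃` = `Skeleton.kappaTilde`,
`λ` = `Skeleton.lam`; `m = d₂k`). AMBIGUITY: no range of `s` is printed; typed in the half-plane
`σ > 1` of absolute convergence of the left side (the right side then supplies the meromorphic
continuation used for `σ > 9/10`). [cite: Zhang2022LandauSiegel, §7 p.40, tex L2101] -/
def Step7u045 : Prop :=
  ∀ (D : ℕ) (d₁ m : ℕ), 0 < d₁ → 0 < m → ∀ s : ℂ, 1 < s.re →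
    kapSer c' D d₁ m s =
      Skeleton.kappaTilde c' D d₁ m s * Skeleton.lam c' D (d₁ * m) s * zetaRatio c' D s

/-- `Z22:§7.u046` CLAIM. "By the simple bounds **`|κ̃(d₁;d₂k,s)| ≤ τ₅(d₁)∏_{q∣d₁}|1 + c/q^σ|`,
`|λ(m,s)| ≤ ∏_{q∣m}|1 + c/q^σ|` for `σ > 9/10`**" (§7 p. 40; `c` an absolute constant; `τ₅` =
`tauFive`). [cite: Zhang2022LandauSiegel, §7 p.40, tex L2105] -/
def Step7u046 : Prop :=
  ∃ c : ℝ, ∀ (D : ℕ) (d₁ m : ℕ), 0 < d₁ → 0 < m → ∀ s : ℂ, 9 / 10 < s.re →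
    ‖Skeleton.kappaTilde c' D d₁ m s‖ ≤
        tauFive d₁ * ∏ q ∈ d₁.primeFactors, |1 + c / (q : ℝ) ^ s.re| ∧
      ‖Skeleton.lam c' D m s‖ ≤ ∏ q ∈ m.primeFactors, |1 + c / (q : ℝ) ^ s.re|

/-- `Z22:§7.u047`, `Z22:§7.u048` CLAIM. "… for `σ > 9/10`, **we can move the contour of integration
in (7.19) to the vertical segments `s = 1 + α + it` (`|t| ≥ D`), `s = 1 − 𝓛⁻¹ + it` (`|t| ≤ D`) and
to the two connecting horizontal segments `s = σ ± iD` (`1 − 𝓛⁻¹ ≤ σ ≤ 1 + α`)**" (§7 p. 40): by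
Cauchy's theorem the (7.19) integral (integrand continued by `Step7u045`) equals the integral over
the shifted contour plus the residues at the three poles `s = 1 − β_j` swept over, namely
`𝔯ⱼ κ̃₀ⱼ(d₁;d₂k) λ₀ⱼ(d₁d₂k) (pk/l₂)^{1−β_j}` (`𝔯ⱼ` = `frakr`, the residue of `resFn`, `Step7u050`).
AMBIGUITY: the move across `σ = 1` to `σ = 1 − 𝓛⁻¹`, `|t| ≤ D` presupposes `ζ(s) ≠ 0` for
`σ ≥ 1 − 𝓛⁻¹`, `|t| ≤ D` (no pole of `ζ(s)⁻¹` swept); the manuscript cites nothing here (Lemma 5.5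
is about `L(s,χ)`; the classical zero-free region gives `σ ≥ 1 − c₀/log(|t|+3)` with `c₀ < 1`); the
displayed error `O(pkε₁/l₂)` of the next node is insensitive to replacing `𝓛⁻¹` by `c𝓛⁻¹`. Typed
as printed. [cite: Zhang2022LandauSiegel, §7 p.40, tex L2108–L2117] -/
def Step7u047 : Prop :=
  Skeleton.ForAllLarge fun D _ χ => Skeleton.AssumptionA D χ →
    ∀ p ∈ Skeleton.primeWindow D, ∀ d₁ d₂ k l₂ : ℕ, 0 < d₁ → 0 < d₂ → 0 < k → 0 < l₂ →
      ((d₂ * l₂ : ℕ) : ℝ) < Skeleton.bigP D / Skeleton.bigT D ^ 2 →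
      ((d₁ * d₂ * k : ℕ) : ℝ) < Skeleton.bigP D / Skeleton.bigT D ^ 2 →
        mellinInv (3 / 2)
            (fun s => Skeleton.kappaTilde c' D d₁ (d₂ * k) s *
              Skeleton.lam c' D (d₁ * d₂ * k) s * resFn c' D s)
            ((l₂ : ℝ) / ((p : ℝ) * k)) =
          contour719 D (fun s =>
              (((l₂ : ℝ) / ((p : ℝ) * k) : ℝ) : ℂ) ^ (-s) *
                (Skeleton.kappaTilde c' D d₁ (d₂ * k) s * Skeleton.lam c' D (d₁ * d₂ * k) s *
                  resFn c' D s)) +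
            ∑ j ∈ Finset.Icc 1 3,
              frakr c' D j * Skeleton.kappaTildeZero c' D j d₁ (d₂ * k) *
                  Skeleton.lamZero c' D j (d₁ * d₂ * k) *
                (((l₂ : ℝ) / ((p : ℝ) * k) : ℝ) : ℂ) ^ (-(1 - Skeleton.betaJ c' D j))

/-- `Z22:§7.u049` CLAIM. "This yields, by Lemma 5.2 (i) and standard estimates, that the integral
(7.18) is equal to the sum of the residues of the integrand at `s = 1 − β_j`, `1 ≤ j ≤ 3`, plus an
acceptable error. Namely we have **`Σ_{(l,kd₂)=1} κ(d₁l)Δ(ll₂/(pk))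
= Σ_{1≤j≤3} 𝔯ⱼ κ̃₀ⱼ(d₁;d₂k) λ₀ⱼ(d₁d₂k) (pk/l₂)^{1−β_j} + O(pkε₁/l₂)`**" (§7 p. 40), under the
ranges `d₂l₂ < PT⁻²`, `d₁d₂k < PT⁻²` of `Step7u044`; `ε₁ = exp{−c𝓛^{1/10}}` (`eps1`).
AMBIGUITY (citation slips, recorded): "Lemma 5.2 (i)" — Lemma 5.2 has no parts; the bound used is
Lemma 5.4 (i) `δ(s) ≪ 𝓛ᶜ|s|⁻²` (`Skeleton.Lemma54`); "the integral (7.18)" — read (7.19).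
[cite: Zhang2022LandauSiegel, §7 p.40, tex L2118–L2121] -/
def Step7u049 : Prop :=
  ∃ c : ℝ, 0 < c ∧ ∃ C : ℝ, Skeleton.ForAllLarge fun D _ χ => Skeleton.AssumptionA D χ →
    ∀ p ∈ Skeleton.primeWindow D, ∀ d₁ d₂ k l₂ : ℕ, 0 < d₁ → 0 < d₂ → 0 < k → 0 < l₂ →
      ((d₂ * l₂ : ℕ) : ℝ) < Skeleton.bigP D / Skeleton.bigT D ^ 2 →
      ((d₁ * d₂ * k : ℕ) : ℝ) < Skeleton.bigP D / Skeleton.bigT D ^ 2 →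
        ‖innerDeltaSum c' D d₁ (d₂ * k) ((l₂ : ℝ) / ((p : ℝ) * k)) -
            ∑ j ∈ Finset.Icc 1 3,
              frakr c' D j * Skeleton.kappaTildeZero c' D j d₁ (d₂ * k) *
                  Skeleton.lamZero c' D j (d₁ * d₂ * k) *
                ((((p : ℝ) * k) / l₂ : ℝ) : ℂ) ^ (1 - Skeleton.betaJ c' D j)‖
          ≤ C * ((p : ℝ) * k * eps1 c D / l₂)

/-- `Z22:§7.u050` CLAIM. "**`𝔯ⱼ` is the residue of the function `ζ(s+β₁)ζ(s+β₂)ζ(s+β₃)ζ(s)⁻¹δ(s)`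
at `s = 1 − β_j`**" (§7 p. 40): the typed value `frakr c' D j` is that residue, i.e.
`(s − (1 − β_j))·resFn(s) → 𝔯ⱼ` as `s → 1 − β_j` (a simple pole; for `D` large the `β_j` are
pairwise distinct and `ζ(1 − β_j) ≠ 0`). [cite: Zhang2022LandauSiegel, §7 p.40, tex L2122–L2126] -/
def Step7u050 : Prop :=
  Skeleton.ForAllLarge fun D _ _ => ∀ j ∈ Finset.Icc 1 3,
    Filter.Tendsto (fun s : ℂ => (s - (1 - Skeleton.betaJ c' D j)) * resFn c' D s)
      (nhdsWithin (1 - Skeleton.betaJ c' D j) {1 - Skeleton.betaJ c' D j}ᶜ)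
      (nhds (frakr c' D j))

/-- `Z22:§7.u052` CLAIM. "This yields **`Σ_{(l₂,k)=1} a₁(d₂l₂) Σ_{(l₁,kd₂)=1} κ(d₁l₁)Δ(l₁l₂/(pk))
= Σ_{1≤j≤3} 𝔯ⱼ (pk)^{1−β_j} [Σ_{d=d₁d₂}] κ̃₀ⱼ(d₁;d₂k) λ₀ⱼ(d₁d₂k) Σ_{(l,k)=1} a₁(d₂l)l^{−(1−β_j)}
+ O(Pkε₁)`** (here we have rewritten `l` for `l₂`)" (§7 p. 41), for `d₁d₂k < PT⁻²`.
AMBIGUITY: the printed right side carries a summation sign `Σ_{d=d₁d₂}` although `d₁, d₂` are free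
on the left (the display is `Step7u049` multiplied by `a₁(d₂l₂)` and summed over `l₂`); typed is
the literal termwise reading (fixed `d₁, d₂`; the stray `Σ_{d=d₁d₂}` dropped) — the alternative
reading sums both sides over the factorisations `d = d₁d₂`, with the same consequence (7.20).
[cite: Zhang2022LandauSiegel, §7 p.41, tex L2131] -/
def Step7u052 : Prop :=
  ∀ B : ℝ, ∃ c : ℝ, 0 < c ∧ ∃ C : ℝ, Skeleton.ForAllLarge fun D _ χ => Skeleton.AssumptionA D χ →
    ∀ a₁ : ℕ → ℂ, Skeleton.Adm72 D B a₁ → ∀ p ∈ Skeleton.primeWindow D,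
      ∀ d₁ d₂ k : ℕ, 0 < d₁ → 0 < d₂ → 0 < k →
        ((d₁ * d₂ * k : ℕ) : ℝ) < Skeleton.bigP D / Skeleton.bigT D ^ 2 →
          ‖(∑' l₂ : ℕ, if 0 < l₂ ∧ Nat.Coprime l₂ k then
                a₁ (d₂ * l₂) * innerDeltaSum c' D d₁ (d₂ * k) ((l₂ : ℝ) / ((p : ℝ) * k)) else 0) -
              ∑ j ∈ Finset.Icc 1 3,
                frakr c' D j * ((((p : ℝ) * k : ℝ) : ℂ) ^ (1 - Skeleton.betaJ c' D j)) *
                    Skeleton.kappaTildeZero c' D j d₁ (d₂ * k) *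
                    Skeleton.lamZero c' D j (d₁ * d₂ * k) *
                  ∑' l : ℕ, if 0 < l ∧ Nat.Coprime l k then
                    a₁ (d₂ * l) / (l : ℂ) ^ (1 - Skeleton.betaJ c' D j) else 0‖
            ≤ C * (Skeleton.bigP D * k * eps1 c D)

/-- `Z22:(7.20)` CLAIM. "Inserting this into (7.18) and rearranging the terms we obtain
**`𝔗₁₁(p) = Σ_{1≤j≤3} 𝔯ⱼ p^{1−β_j} S*ⱼ(𝐚₁,𝐚₂) + O(Pε₁)`**" (§7 p. 41; `S*ⱼ` = `SjStar`,
`ε₁ = exp{−c𝓛^{1/10}}`). Refines `Skeleton.Ded71 c'`.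
[cite: Zhang2022LandauSiegel, §7 (7.20) p.41, tex L2138] -/
def Eq720 : Prop :=
  ∀ B : ℝ, ∃ c : ℝ, 0 < c ∧ ∃ C : ℝ, Skeleton.ForAllLarge fun D _ χ => Skeleton.AssumptionA D χ →
    ∀ a₁ a₂ : ℕ → ℂ, Skeleton.Adm72 D B a₁ → Skeleton.Adm72 D B a₂ →
      ∀ p ∈ Skeleton.primeWindow D,
        ‖Iface.frakT11 c' D a₁ a₂ p -
            ∑ j ∈ Finset.Icc 1 3,
              frakr c' D j * (p : ℂ) ^ (1 - Skeleton.betaJ c' D j) * SjStar c' D j a₁ a₂‖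
          ≤ C * (Skeleton.bigP D * eps1 c D)

/-- `Z22:§7.u054` CLAIM (arithmetic identity). "By the Möbius inversion,
**`S*ⱼ(𝐚₁,𝐚₂) = Σ_d Σ_{d₁} Σ_k a₂(d₁dk)κ̃₀ⱼ(d₁;dk)λ₀ⱼ(d₁dk)μ(k)/(d₁dφ(k)k^{β_j})
· Σ_l a₁(dl)l^{−(1−β_j)} (Σ_{r∣(k,l)} μ(r))`**" (§7 p. 41): the coprimality condition `(l,k) = 1`
replaced by `Σ_{r∣(k,l)} μ(r)`. [cite: Zhang2022LandauSiegel, §7 p.41, tex L2146] -/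
def Step7u054 : Prop :=
  ∀ (D : ℕ) (j : ℕ) (a₁ a₂ : ℕ → ℂ),
    SjStar c' D j a₁ a₂ =
      ∑ d ∈ Finset.Ico 1 (Skeleton.Nsupp D), ∑ d₁ ∈ Finset.Ico 1 (Skeleton.Nsupp D),
        ∑ k ∈ Finset.Ico 1 (Skeleton.Nsupp D),
          a₂ (d₁ * d * k) * Skeleton.kappaTildeZero c' D j d₁ (d * k) *
                Skeleton.lamZero c' D j (d₁ * d * k) * (ArithmeticFunction.moebius k : ℂ) /
              ((d₁ : ℂ) * d * (Nat.totient k : ℂ) * (k : ℂ) ^ Skeleton.betaJ c' D j) *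
            ∑ l ∈ Finset.Ico 1 (Skeleton.Nsupp D),
              a₁ (d * l) / (l : ℂ) ^ (1 - Skeleton.betaJ c' D j) *
                ∑ r ∈ (Nat.gcd k l).divisors, (ArithmeticFunction.moebius r : ℂ)

/-- `Z22:§7.u055` CLAIM (rearrangement). "This yields, by substituting `k = rk₁`, `l = rm`,
`n = d₁k₁` and changing the order of summation, **`S*ⱼ(𝐚₁,𝐚₂) = Σ_r Σ_d |μ(r)|/(drφ(r))
Σ_m a₁(drm)m^{−(1−β_j)} Σ_n a₂(drn)λ₀ⱼ(drn)n⁻¹ Σ_{n=d₁k₁, (k₁,r)=1} κ̃₀ⱼ(d₁;drk₁)μ(k₁)k₁^{1−β_j}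
/φ(k₁)`**" (§7 p. 41), for `𝐚₁, 𝐚₂` satisfying (7.2) (finite sums, truncated at `⌈PT⁻²⌉`).
[cite: Zhang2022LandauSiegel, §7 p.41, tex L2152] -/
def Step7u055 : Prop :=
  ∀ (D : ℕ) (B : ℝ) (j : ℕ) (a₁ a₂ : ℕ → ℂ), Skeleton.Adm72 D B a₁ → Skeleton.Adm72 D B a₂ →
    SjStar c' D j a₁ a₂ =
      ∑ r ∈ Finset.Ico 1 (Skeleton.Nsupp D), ∑ d ∈ Finset.Ico 1 (Skeleton.Nsupp D),
        ((ArithmeticFunction.moebius r).natAbs : ℂ) / ((d : ℂ) * r * (Nat.totient r : ℂ)) *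
          (∑ m ∈ Finset.Ico 1 (Skeleton.Nsupp D),
              a₁ (d * r * m) / (m : ℂ) ^ (1 - Skeleton.betaJ c' D j)) *
            ∑ n ∈ Finset.Ico 1 (Skeleton.Nsupp D),
              a₂ (d * r * n) * Skeleton.lamZero c' D j (d * r * n) / (n : ℂ) *
                ∑ k₁ ∈ n.divisors.filter (fun k₁ => Nat.Coprime k₁ r),
                  Skeleton.kappaTildeZero c' D j (n / k₁) (d * r * k₁) *
                      (ArithmeticFunction.moebius k₁ : ℂ) *
                    (k₁ : ℂ) ^ (1 - Skeleton.betaJ c' D j) / (Nat.totient k₁ : ℂ)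

/-- `Z22:§7.u056` CLAIM (identity). "Since **`λ₀ⱼ(drn) = λ₀ⱼ(dr)λ̃₀ⱼ(n,dr)`**" (§7 p. 41;
`λ₀ⱼ` = `Skeleton.lamZero`, `λ̃₀ⱼ` = `Skeleton.lamTildeZero`).
[cite: Zhang2022LandauSiegel, §7 p.41, tex L2156] -/
def Step7u056 : Prop :=
  ∀ (D : ℕ) (j d r n : ℕ), 0 < d → 0 < r → 0 < n →
    Skeleton.lamZero c' D j (d * r * n) =
      Skeleton.lamZero c' D j (d * r) * Skeleton.lamTildeZero c' D j n (d * r)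

/-- `Z22:§7.u057` CLAIM (identity). "it follows that **`λ₀ⱼ(drn) Σ_{n=d₁k₁, (k₁,r)=1}
κ̃₀ⱼ(d₁;drk₁)μ(k₁)k₁^{1−β_j}/φ(k₁) = λ₀ⱼ(dr)ξ₀ⱼ(n;d,r)`**" (§7 p. 41; `ξ₀ⱼ` = `Skeleton.xiZero`).
[cite: Zhang2022LandauSiegel, §7 p.41, tex L2160] -/
def Step7u057 : Prop :=
  ∀ (D : ℕ) (j d r n : ℕ), 0 < d → 0 < r → 0 < n →
    Skeleton.lamZero c' D j (d * r * n) *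
        ∑ k₁ ∈ n.divisors.filter (fun k₁ => Nat.Coprime k₁ r),
          Skeleton.kappaTildeZero c' D j (n / k₁) (d * r * k₁) *
              (ArithmeticFunction.moebius k₁ : ℂ) *
            (k₁ : ℂ) ^ (1 - Skeleton.betaJ c' D j) / (Nat.totient k₁ : ℂ) =
      Skeleton.lamZero c' D j (d * r) * Skeleton.xiZero c' D j n d r

/-- `Z22:(7.21)` CLAIM. "Hence **`S*ⱼ(𝐚₁,𝐚₂) = S_j(𝐚₁,𝐚₂)`**" (§7 p. 41; `S_j` = `Skeleton.Sj`),
for `𝐚₁, 𝐚₂` satisfying (7.2). Refines `Skeleton.Ded71 c'`.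
[cite: Zhang2022LandauSiegel, §7 (7.21) p.41, tex L2165] -/
def Eq721 : Prop :=
  ∀ (D : ℕ) (B : ℝ) (j : ℕ) (a₁ a₂ : ℕ → ℂ), Skeleton.Adm72 D B a₁ → Skeleton.Adm72 D B a₂ →
    SjStar c' D j a₁ a₂ = Skeleton.Sj c' D j a₁ a₂

/-- `Z22:§7.u058` CLAIM. "On the other hand, by Lemma 5.2 (ii) and direct calculation we have
**`i𝔯₁p^{−β₁} = 1/(2α) + O(𝓛)`**" (§7 p. 42), for `p ∼ P`. AMBIGUITY (citation slip, recorded):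
Lemma 5.2 has no part (ii); the input used is Lemma 5.4 (ii), `δ(s) = 1 + O(α log 𝓛)` for
`|s − 1| < 10α` (`Skeleton.Lemma54`). [cite: Zhang2022LandauSiegel, §7 p.42, tex L2169] -/
def Step7u058 : Prop :=
  ∃ C : ℝ, Skeleton.ForAllLarge fun D _ χ => Skeleton.AssumptionA D χ →
    ∀ p ∈ Skeleton.primeWindow D,
      ‖I * frakr c' D 1 * (p : ℂ) ^ (-Skeleton.beta1 c' D) - 1 / (2 * (Skeleton.alpha D : ℂ))‖
        ≤ C * Skeleton.ell D

/-- `Z22:§7.u059` CLAIM. "**`i𝔯₂p^{−β₂} = 2/α + O(𝓛)`**" (§7 p. 42), for `p ∼ P` (by "Lemma 5.2 (ii)"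
— read Lemma 5.4 (ii) — and direct calculation). [cite: Zhang2022LandauSiegel, §7 p.42, tex L2172] -/
def Step7u059 : Prop :=
  ∃ C : ℝ, Skeleton.ForAllLarge fun D _ χ => Skeleton.AssumptionA D χ →
    ∀ p ∈ Skeleton.primeWindow D,
      ‖I * frakr c' D 2 * (p : ℂ) ^ (-Skeleton.beta2 c' D) - 2 / (Skeleton.alpha D : ℂ)‖
        ≤ C * Skeleton.ell D

/-- `Z22:§7.u060` CLAIM. "**`i𝔯₃p^{−β₃} = 3/(2α) + O(𝓛)`**" (§7 p. 42), for `p ∼ P` (by "Lemma 5.2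
(ii)" — read Lemma 5.4 (ii) — and direct calculation).
[cite: Zhang2022LandauSiegel, §7 p.42, tex L2175] -/
def Step7u060 : Prop :=
  ∃ C : ℝ, Skeleton.ForAllLarge fun D _ χ => Skeleton.AssumptionA D χ →
    ∀ p ∈ Skeleton.primeWindow D,
      ‖I * frakr c' D 3 * (p : ℂ) ^ (-Skeleton.beta3 c' D) - 3 / (2 * (Skeleton.alpha D : ℂ))‖
        ≤ C * Skeleton.ell D

/-- `Z22:Prop7.1.pf.c-main` DEDUCTION node. "*Proof of Proposition 7.1: The main term.* In this
subsection we prove (7.10). … Combining these with (7.20) and (7.21) we obtain (7.10), and complete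
the proof of Proposition 7.1." (§7 pp. 39–42): the manuscript's derivation of (7.10) from the
displayed steps of part (c), as ONE named implication over this file's step claims, in the printed
order. Refines `Skeleton.Ded71 c'` (its (7.16)–(7.21) segment; the conclusion (7.10) is the
interface stub `Iface.Eq710`, owned by slice L2-t3). CLAIM, stated not asserted.
[cite: Zhang2022LandauSiegel, §7 pp.39–42, tex L2063–L2178] -/
def DedProp71c : Prop :=
  Eq716 c' → Step7u042 c' → Eq717 c' → Step7u043 c' → Eq718 c' → Eq719 c' → Step7u044 →
    Step7u045a → Step7u045 c' → Step7u046 c' → Step7u047 c' → Step7u049 c' → Step7u050 c' →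
    Step7u052 c' → Eq720 c' → Step7u054 c' → Step7u055 c' → Step7u056 c' → Step7u057 c' →
    Eq721 c' → Step7u058 c' → Step7u059 c' → Step7u060 c' → Iface.Eq710 c'

end Claims

end Literature.NumberTheory.LFunctions.Zhang2022.Section7dStatements
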